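import Literature.Probability.RandomPlanarGeometry.WholePlaneHullLC
import Literature.Probability.RandomPlanarGeometry.CaratheodoryLC
import Literature.Analysis.Complex.LengthAreaDiameter
import HarnessLib

/-!
# Carathéodory for the whole-plane map: `w ↦ F_b(1/w)` extends continuously to the closed punctured disc

Topic `Probability/RandomPlanarGeometry`; definitions with bodies (local length–area integrands)
and proved theorems (no named fact). Sequel of `WholePlaneHullLC` and of the Carathéodory files
`CaratheodoryLC` (Pommerenke (1992), Thm. 2.1 (iv) ⇒ (i), for bounded images) and
`Literature.Analysis.Complex.LengthArea` (Wolff's lemma on the whole disc). The inverse whole-plane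
Loewner map in the interior coordinate, `Φ_b(w) = F_b(1/w)`, is a conformal map of the punctured
disc `𝔻 ∖ {0}` onto the unbounded domain `ℂ ∖ K_b` with a pole at `0`, so neither the bounded-image
continuity theorem nor the whole-disc length–area lemma applies verbatim; this file localises
both near the unit circle:

* `LocalLengthArea.*` — the length–area inequality `∫ r Λ(r)² dr ≤ 2π · area f(U)` for an
  injective holomorphic `f` on an open set `U`, with the circles about the boundary point `ζ`
  parametrised by `cpt ζ r t = ζ - ζ r e^{it}` as in `LengthArea.lean` (the open-set integrands
  `sqDerOn`, `derOn` and the area formula `volume_image_eq_lintegral_of_isOpen` are those of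
  `Literature/Analysis/Complex/LengthAreaDiameter.lean`; the angular integrals `angSqOn`/`angLenOn`
  are the `cpt`-parametrised counterparts of its `angSqAt`/`angLenAt` — equal to them by the
  rotation `t ↦ t + arg(-ζ)` of the parameter — kept in the `cpt` frame because the crosscut
  toolkit `mem_ball_cpt_iff_abs_lt`, `hasDerivAt_cpt`, `exists_eq_cpt` of `LengthArea.lean` is
  written in it, and re-derived in three short lemmas from `lintegral_eq_lintegral_polar` rather
  than by that change of variables), and Wolff's short crosscuts at `ζ ∈ ∂𝔻` for a map of the
  punctured disc bounded near the circle (`exists_short_crosscut_punctured`, with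
  `U = 𝔻 ∩ B(ζ, 1/2)` and radii `< 1/2`);
* `WholePlaneLoewnerChain.image_inter_ball_subset_of_hull` — Pommerenke's Janiszewski step with
  the compact set `B = K_b` and the unbounded domain `ℂ ∖ K_b`;
* `WholePlaneLoewnerChain.exists_forall_dist_lt_of_ulc`, `continuousOn_extendFrom_invMap_inv` —
  **if `K_b` is uniformly locally connected then `Φ_b` extends continuously to `𝔻̄ ∖ {0}`**, with
  boundary values in `K_b` (`extendFrom_invMap_inv_mem_hull`).

With `WholePlaneLoewnerChain.isUniformlyLocallyConnected_hull` this gives the continuous extension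
of `1/g_b⁻¹` in Miller–Sheffield (2013), proof of Prop. 2.5, for every base time, whenever the
radial pieces are generated by continuous curves (boundary hitting allowed).

## References

* Ch. Pommerenke, *Boundary Behaviour of Conformal Maps*, Springer (1992), Prop. 2.2, Thm. 2.1.
  [PommerenkeBBCM1992]
* J. Miller, S. Sheffield, *Imaginary geometry IV*, PTRF 169 (2017), arXiv:1302.4738, Prop. 2.5
  (proof). [MillerSheffield2013]
-/

noncomputable section

open Set Filter Topology Metric Complex MeasureTheory Real
open scoped NNReal ENNReal
open Literature.Topology.PlaneTopology
open Literature.Analysis.Complex.LengthArea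

namespace Literature.Probability.RandomPlanarGeometry

/-! ### The length–area inequality on an open set -/

namespace LocalLengthArea

variable {f : ℂ → ℂ} {U : Set ℂ} {ζ : ℂ}

/-- The angular integral of `‖f'‖²` over the circle of radius `r` about `ζ`, parametrised by
`cpt ζ r` (integrand `sqDerOn U f`, `0` off `U`); the `cpt`-frame counterpart of
`LengthArea.angSqAt` (`LengthAreaDiameter.lean`). [folklore] -/
def angSqOn (U : Set ℂ) (f : ℂ → ℂ) (ζ : ℂ) (r : ℝ) : ℝ≥0∞ :=
  ∫⁻ t in Ioo (-π) π, sqDerOn U f (cpt ζ r t)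

/-- The angular integral of `‖f'‖` over the circle of radius `r` about `ζ`, parametrised by
`cpt ζ r` (integrand `derOn U f`); the crosscut `U ∩ {|w - ζ| = r}` has length `r * angLenOn`;
the `cpt`-frame counterpart of `LengthArea.angLenAt`. [folklore] -/
def angLenOn (U : Set ℂ) (f : ℂ → ℂ) (ζ : ℂ) (r : ℝ) : ℝ≥0∞ :=
  ∫⁻ t in Ioo (-π) π, derOn U f (cpt ζ r t)

/-- **Area in polar coordinates about `ζ`**: `∫_{r>0} r ∫ ‖f'‖² 1_U dt dr = area f(U)`. [folklore] -/
theorem lintegral_angSqOn_eq_volume (hUo : IsOpen U) (hf : DifferentiableOn ℂ f U)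
    (hinj : InjOn f U) (hζ : ‖ζ‖ = 1) :
    ∫⁻ r in Ioi (0 : ℝ), ENNReal.ofReal r * angSqOn U f ζ r = volume (f '' U) := by
  rw [volume_image_eq_lintegral_of_isOpen hUo hf hinj, ← lintegral_indicator hUo.measurableSet,
    show (fun w ↦ U.indicator (fun w ↦ ENNReal.ofReal (‖deriv f w‖ ^ 2)) w) = sqDerOn U f from rfl,
    lintegral_eq_lintegral_polar hζ, lintegral_polarCoord_target_eq]
  · refine setLIntegral_congr_fun measurableSet_Ioi fun r _ ↦ ?_
    rw [angSqOn, lintegral_const_mul' _ _ ENNReal.ofReal_ne_top]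
  · exact measurable_fst.ennreal_ofReal.mul
      ((measurable_sqDerOn hUo f).comp (continuous_cpt_uncurry ζ).measurable)

/-- **Cauchy–Schwarz** for the angular integrals. [folklore] -/
theorem angLenOn_sq_le (hU : IsOpen U) (f : ℂ → ℂ) (ζ : ℂ) (r : ℝ) :
    angLenOn U f ζ r ^ 2 ≤ ENNReal.ofReal (2 * π) * angSqOn U f ζ r := by
  set μ : Measure ℝ := volume.restrict (Ioo (-π) π) with hμ
  have hmeas : AEMeasurable (fun t ↦ derOn U f (cpt ζ r t)) μ :=
    ((measurable_derOn hU f).comp (continuous_cpt ζ r).measurable).aemeasurable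
  have h := ENNReal.lintegral_mul_le_Lp_mul_Lq μ Real.HolderConjugate.two_two hmeas
    (g := fun _ ↦ 1) aemeasurable_const
  simp only [Pi.mul_apply, mul_one, lintegral_const, ENNReal.rpow_two, one_pow, one_mul] at h
  have hvol : μ univ = ENNReal.ofReal (2 * π) := by
    rw [hμ, Measure.restrict_apply_univ, Real.volume_Ioo]; ring_nf
  rw [hvol] at h
  have hsq : ∫⁻ a, derOn U f (cpt ζ r a) ^ 2 ∂μ = angSqOn U f ζ r := by
    simp only [derOn_sq]; rfl
  rw [hsq] at h
  calc angLenOn U f ζ r ^ 2 = (∫⁻ a, derOn U f (cpt ζ r a) ∂μ) ^ 2 := rfl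
    _ ≤ (angSqOn U f ζ r ^ (1 / 2 : ℝ) * ENNReal.ofReal (2 * π) ^ (1 / 2 : ℝ)) ^ 2 := by
      gcongr
    _ = ENNReal.ofReal (2 * π) * angSqOn U f ζ r := by
      rw [← ENNReal.mul_rpow_of_nonneg _ _ (by norm_num : (0 : ℝ) ≤ 1 / 2), ← ENNReal.rpow_two,
        ← ENNReal.rpow_mul]
      norm_num [mul_comm]

/-- **Length–area inequality on an open set**, `cpt` frame: `∫_{r>0} r Λ_U(r)² dr ≤ 2π · area f(U)`
(the counterpart of `LengthArea.lintegral_angLenAt_sq_le` of `LengthAreaDiameter.lean`).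
Pommerenke (1992), Prop. 2.2, (6). [cite: PommerenkeBBCM1992, Prop. 2.2] -/
theorem lintegral_angLenOn_sq_le (hUo : IsOpen U) (hf : DifferentiableOn ℂ f U)
    (hinj : InjOn f U) (hζ : ‖ζ‖ = 1) :
    ∫⁻ r in Ioi (0 : ℝ), ENNReal.ofReal r * angLenOn U f ζ r ^ 2
      ≤ ENNReal.ofReal (2 * π) * volume (f '' U) := by
  calc ∫⁻ r in Ioi (0 : ℝ), ENNReal.ofReal r * angLenOn U f ζ r ^ 2
      ≤ ∫⁻ r in Ioi (0 : ℝ), ENNReal.ofReal (2 * π) * (ENNReal.ofReal r * angSqOn U f ζ r) := by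
        refine lintegral_mono fun r ↦ ?_
        rw [mul_left_comm]
        gcongr
        exact angLenOn_sq_le hUo f ζ r
    _ = ENNReal.ofReal (2 * π) * volume (f '' U) := by
        rw [lintegral_const_mul' _ _ ENNReal.ofReal_ne_top, lintegral_angSqOn_eq_volume hUo hf hinj hζ]

/-- Points of the crosscut arc of radius `r < 1/2` inside the disc lie in `𝔻 ∩ B(ζ, 1/2)`, and in
particular off the origin. [folklore] -/
theorem cpt_mem_inter (hζ : ‖ζ‖ = 1) {r : ℝ} (hr : r ∈ Ioo (0 : ℝ) (1 / 2)) {t : ℝ}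
    (ht : t ∈ Ioo (-arccos (r / 2)) (arccos (r / 2))) :
    cpt ζ r t ∈ ball (0 : ℂ) 1 ∩ ball ζ (1 / 2) := by
  have habs : |t| < arccos (r / 2) := abs_lt.2 ht
  refine ⟨(mem_ball_cpt_iff_abs_lt hζ hr.1 (by linarith [hr.2]) (habs.le.trans (arccos_le_pi _))).2 habs,
    ?_⟩
  rw [mem_ball, dist_eq_norm, norm_cpt_sub hζ, abs_of_pos hr.1]
  exact hr.2

/-- `𝔻 ∩ B(ζ, 1/2)` avoids the origin (`‖ζ‖ = 1`). [folklore] -/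
theorem inter_ball_subset_punctured (hζ : ‖ζ‖ = 1) :
    ball (0 : ℂ) 1 ∩ ball ζ (1 / 2) ⊆ ball (0 : ℂ) 1 \ {0} := by
  rintro w ⟨hw, hwζ⟩
  refine ⟨hw, fun hw0 ↦ ?_⟩
  rw [mem_singleton_iff] at hw0
  rw [hw0, mem_ball, dist_eq_norm, zero_sub, norm_neg, hζ] at hwζ
  norm_num at hwζ

/-- **Wolff's lemma for a map of the punctured disc**: let `f` be holomorphic and injective on
`𝔻 ∖ {0}` and bounded on `𝔻 ∩ B(ζ, 1/2)`, `‖ζ‖ = 1`. For every `ε > 0` there is `r ∈ (0, 1/2)`,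
`r ≤ ε`, such that the crosscut `t ↦ f (ζ - ζ r e^{it})`, `|t| < arccos (r/2)`, has endpoints
`a, b`, stays within `ε` of `a`, and `dist a b ≤ ε`. Pommerenke (1992), Prop. 2.2.
[cite: PommerenkeBBCM1992, Prop. 2.2] -/
theorem exists_short_crosscut_punctured (hf : DifferentiableOn ℂ f (ball (0 : ℂ) 1 \ {0}))
    (hinj : InjOn f (ball (0 : ℂ) 1 \ {0}))
    (hbdd : Bornology.IsBounded (f '' (ball (0 : ℂ) 1 ∩ ball ζ (1 / 2)))) (hζ : ‖ζ‖ = 1)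
    {ε : ℝ} (hε : 0 < ε) :
    ∃ r ∈ Ioo (0 : ℝ) (1 / 2), r ≤ ε ∧ ∃ a b : ℂ,
      Tendsto (fun t ↦ f (cpt ζ r t)) (𝓝[>] (-arccos (r / 2))) (𝓝 a) ∧
      Tendsto (fun t ↦ f (cpt ζ r t)) (𝓝[<] (arccos (r / 2))) (𝓝 b) ∧
      (∀ t ∈ Ioo (-arccos (r / 2)) (arccos (r / 2)), dist (f (cpt ζ r t)) a ≤ ε) ∧
      dist a b ≤ ε := by
  set U : Set ℂ := ball (0 : ℂ) 1 ∩ ball ζ (1 / 2) with hU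
  have hUo : IsOpen U := isOpen_ball.inter isOpen_ball
  have hUS : U ⊆ ball (0 : ℂ) 1 \ {0} := inter_ball_subset_punctured hζ
  have hfU : DifferentiableOn ℂ f U := hf.mono hUS
  have hinjU : InjOn f U := hinj.mono hUS
  have hopen : IsOpen (ball (0 : ℂ) 1 \ {0}) := isOpen_ball.sdiff isClosed_singleton
  -- finiteness of the truncated length–area integral
  set Λ : ℝ → ℝ≥0∞ := fun r ↦ if r < 1 / 2 then angLenOn U f ζ r else 0 with hΛ
  have hK : ∫⁻ r in Ioi (0 : ℝ), ENNReal.ofReal r * Λ r ^ 2 ≠ ⊤ := by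
    refine ne_top_of_le_ne_top ?_ (lintegral_mono fun r ↦ ?_ : ∫⁻ r in Ioi (0 : ℝ), ENNReal.ofReal r * Λ r ^ 2
        ≤ ∫⁻ r in Ioi (0 : ℝ), ENNReal.ofReal r * angLenOn U f ζ r ^ 2)
    · exact ne_top_of_le_ne_top (ENNReal.mul_ne_top ENNReal.ofReal_ne_top hbdd.measure_lt_top.ne)
        (lintegral_angLenOn_sq_le hUo hfU hinjU hζ)
    · show ENNReal.ofReal r * Λ r ^ 2 ≤ ENNReal.ofReal r * angLenOn U f ζ r ^ 2
      simp only [hΛ]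
      split_ifs
      · exact le_rfl
      · simp
  obtain ⟨r, ⟨hr0, hr1⟩, hrε, hlen⟩ :=
    exists_mul_le_of_lintegral_ne_top hK (lt_min hε (by norm_num : (0 : ℝ) < 1 / 4))
  have hrlt : r < 1 / 2 := by linarith [hrε.trans (min_le_right _ _)]
  have hrε' : r ≤ ε := hrε.trans (min_le_left _ _)
  have hr : r ∈ Ioo (0 : ℝ) (1 / 2) := ⟨hr0, hrlt⟩
  have hΛr : Λ r = angLenOn U f ζ r := by simp only [hΛ]; rw [if_pos hrlt]
  rw [hΛr] at hlen
  set α : ℝ := arccos (r / 2) with hα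
  have hαpos : 0 < α := arccos_pos.2 (by linarith)
  have hαpi : α ≤ π := arccos_le_pi _
  have hmem : ∀ s ∈ Ioo (-α) α, cpt ζ r s ∈ U := fun s hs ↦ cpt_mem_inter hζ hr hs
  -- the crosscut as a `C¹` curve of length `≤ min ε (1/4) ≤ ε`
  set c : ℝ → ℂ := fun t ↦ f (cpt ζ r t) with hc
  set c' : ℝ → ℂ := fun t ↦ deriv f (cpt ζ r t) * -(ζ * (circleMap 0 r t * I)) with hc'
  have hderiv : ∀ s ∈ Ioo (-α) α, HasDerivAt c (c' s) s := fun s hs ↦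
    ((hf.differentiableAt (hopen.mem_nhds (hUS (hmem s hs)))).hasDerivAt.comp s
      (hasDerivAt_cpt ζ r s))
  have hcont : ContinuousOn c' (Ioo (-α) α) := by
    have hd : ContinuousOn (deriv f) (ball (0 : ℂ) 1 \ {0}) :=
      ((hf.analyticOnNhd hopen).deriv).continuousOn
    refine (hd.comp (continuous_cpt ζ r).continuousOn fun s hs ↦ hUS (hmem s hs)).mul ?_
    fun_prop
  have hL : ∫⁻ s in Ioo (-α) α, ‖c' s‖ₑ ≤ ENNReal.ofReal (min ε (1 / 4)) := by
    calc ∫⁻ s in Ioo (-α) α, ‖c' s‖ₑ = ∫⁻ s in Ioo (-α) α, derOn U f (cpt ζ r s) * ENNReal.ofReal r := by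
          refine setLIntegral_congr_fun measurableSet_Ioo fun s hs ↦ ?_
          rw [hc', enorm_mul, derOn, indicator_of_mem (hmem s hs), ofReal_norm,
            ← ofReal_norm (-(ζ * (circleMap 0 r s * I))), norm_deriv_cpt hζ hr0.le]
      _ = (∫⁻ s in Ioo (-α) α, derOn U f (cpt ζ r s)) * ENNReal.ofReal r :=
          lintegral_mul_const' _ _ ENNReal.ofReal_ne_top
      _ ≤ angLenOn U f ζ r * ENNReal.ofReal r := by
          gcongr
          exact lintegral_mono_set (Ioo_subset_Ioo (neg_le_neg hαpi) hαpi)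
      _ ≤ ENNReal.ofReal (min ε (1 / 4)) := by rwa [mul_comm]
  have hLtop : ∫⁻ s in Ioo (-α) α, ‖c' s‖ₑ ≠ ⊤ := ne_top_of_le_ne_top ENNReal.ofReal_ne_top hL
  have hLε : (∫⁻ s in Ioo (-α) α, ‖c' s‖ₑ).toReal ≤ ε :=
    (ENNReal.toReal_le_of_le_ofReal (le_min hε.le (by norm_num)) hL).trans (min_le_left _ _)
  have hab : -α < α := by linarith
  obtain ⟨a, ha⟩ := exists_tendsto_nhdsGT hab hderiv hcont hLtop
  obtain ⟨b, hb⟩ := exists_tendsto_nhdsLT hab hderiv hcont hLtop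
  refine ⟨r, hr, hrε', a, b, ha, hb, fun t ht ↦ ?_, ?_⟩
  · exact (dist_le_of_tendsto hderiv hcont hLtop ha hab ht).trans hLε
  · exact (dist_le_of_tendsto_of_tendsto hderiv hcont hLtop ha hb hab).trans hLε

end LocalLengthArea

/-! ### The Janiszewski step for `Φ_b : 𝔻 ∖ {0} → ℂ ∖ K_b` -/

namespace WholePlaneLoewnerChain

open LocalLengthArea

variable {lam : ℝ → ℝ}

/-- The interior-coordinate inverse `Φ_b(w) = F_b(1/w)` maps the punctured disc onto `ℂ ∖ K_b`.
[cite: Lawler2005, §4.3 Prop. 4.21] -/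
theorem image_invMap_inv_eq_compl_hull (C : WholePlaneLoewnerChain lam) (hlam : Continuous lam) (b : ℝ) :
    (fun w : ℂ ↦ WholePlaneLoewner.BackwardFlow.invMap lam b w⁻¹) '' (ball (0 : ℂ) 1 \ {0}) =
      (C.hull b)ᶜ := by
  ext z
  constructor
  · rintro ⟨w, hw, rfl⟩
    exact C.invMap_inv_notMem_hull hlam hw.2 (mem_ball_zero_iff.1 hw.1)
  · intro hz
    exact ⟨(C.map b z)⁻¹, C.invCoord_mem hz, C.invMap_inv_invCoord hlam hz⟩

/-- `Φ_b` is holomorphic on the punctured disc. [cite: Lawler2005, §4.3 Prop. 4.21] -/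
theorem differentiableOn_invMap_inv (hlam : Continuous lam) (b : ℝ) :
    DifferentiableOn ℂ (fun w : ℂ ↦ WholePlaneLoewner.BackwardFlow.invMap lam b w⁻¹)
      (ball (0 : ℂ) 1 \ {0}) := by
  refine (WholePlaneLoewner.BackwardFlow.differentiableOn_invMap hlam b).comp
    (differentiableOn_inv.mono fun w hw ↦ hw.2) fun w hw ↦ ?_
  show 1 < ‖w⁻¹‖
  rw [norm_inv]
  exact (one_lt_inv₀ (norm_pos_iff.2 hw.2)).2 (mem_ball_zero_iff.1 hw.1)

/-- `Φ_b` is injective on the punctured disc. [folklore] -/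
theorem injOn_invMap_inv (C : WholePlaneLoewnerChain lam) (hlam : Continuous lam) (b : ℝ) :
    InjOn (fun w : ℂ ↦ WholePlaneLoewner.BackwardFlow.invMap lam b w⁻¹) (ball (0 : ℂ) 1 \ {0}) := by
  intro w hw w' hw' h
  have h' : WholePlaneLoewner.BackwardFlow.invMap lam b w⁻¹ = WholePlaneLoewner.BackwardFlow.invMap lam b w'⁻¹ := h
  have h1 := C.invCoord_invMap_inv hlam (b := b) hw.2 (mem_ball_zero_iff.1 hw.1)
  have h2 := C.invCoord_invMap_inv hlam (b := b) hw'.2 (mem_ball_zero_iff.1 hw'.1)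
  rw [← h1, ← h2, h']

/-- `Φ_b` is bounded on `{1/2 < |w| < 1}` (by `8 eᵇ`, Koebe at infinity). [cite: Lawler2005, Thm. 3.17] -/
theorem norm_invMap_inv_le (hlam : Continuous lam) (b : ℝ) {w : ℂ} (hw1 : ‖w‖ < 1) (hw2 : 1 / 2 < ‖w‖) :
    ‖WholePlaneLoewner.BackwardFlow.invMap lam b w⁻¹‖ ≤ 4 * 2 * Real.exp b := by
  have hw0 : 0 < ‖w‖ := by linarith
  refine WholePlaneLoewner.BackwardFlow.norm_invMap_le_of_norm_le hlam b ?_ ?_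
  · rw [norm_inv]; exact (one_lt_inv₀ hw0).2 hw1
  · rw [norm_inv]
    rw [inv_le_comm₀ hw0 (by norm_num : (0 : ℝ) < 2)]
    linarith

/-- **Boundary limits of `Φ_b` are points of `K_b`.** If `g → x` with `‖x‖ = 1` along a filter,
`g` eventually in the punctured disc, and `Φ_b ∘ g → a`, then `a ∈ K_b`. [folklore] -/
theorem mem_hull_of_tendsto (C : WholePlaneLoewnerChain lam) (hlam : Continuous lam) (b : ℝ) {ι : Type*} {l : Filter ι} [NeBot l] {g : ι → ℂ}
    (hg : ∀ᶠ t in l, g t ∈ ball (0 : ℂ) 1 \ {0}) {x : ℂ} (hx : ‖x‖ = 1) (hgx : Tendsto g l (𝓝 x))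
    {a : ℂ} (ha : Tendsto (fun t ↦ WholePlaneLoewner.BackwardFlow.invMap lam b (g t)⁻¹) l (𝓝 a)) :
    a ∈ C.hull b := by
  by_contra haK
  have hΨ : ContinuousAt (fun z ↦ (C.map b z)⁻¹) a :=
    (C.continuousOn_invCoord b).continuousAt ((C.isCompact_hull b).isClosed.isOpen_compl.mem_nhds haK)
  have h1 : Tendsto (fun t ↦ (C.map b (WholePlaneLoewner.BackwardFlow.invMap lam b (g t)⁻¹))⁻¹) l
      (𝓝 ((C.map b a)⁻¹)) := hΨ.tendsto.comp ha
  have h2 : Tendsto (fun t ↦ (C.map b (WholePlaneLoewner.BackwardFlow.invMap lam b (g t)⁻¹))⁻¹) l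
      (𝓝 x) :=
    hgx.congr' (hg.mono fun t ht ↦ (C.invCoord_invMap_inv hlam ht.2 (mem_ball_zero_iff.1 ht.1)).symm)
  have := tendsto_nhds_unique h1 h2
  have hmem := C.invCoord_mem haK
  rw [this] at hmem
  have h3 : ‖x‖ < 1 := mem_ball_zero_iff.1 hmem.1
  rw [hx] at h3
  exact lt_irrefl _ h3

/-- **The near side of a short crosscut is small** (Pommerenke's Janiszewski step, for
`Φ_b : 𝔻 ∖ {0} → ℂ ∖ K_b` with the compact set `K_b`): let `C` be the crosscut
`t ↦ Φ_b (ζ - ζ r e^{it})`, `|t| < arccos (r/2)`, `r < 1/2`, with endpoints `a, b'`; let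
`σ ⊆ K_b` be compact preconnected containing `a, b'`, everything within `R` of `a`; and suppose the
point `Φ_b(-ζ/2)` is at distance `> R` from `a`. Then `Φ_b` maps `(𝔻 ∖ {0}) ∩ {|w - ζ| < r}`
into the closed `R`-disc about `a`. [cite: PommerenkeBBCM1992, Thm. 2.1] -/
theorem image_inter_ball_subset_of_hull (C : WholePlaneLoewnerChain lam) (hlam : Continuous lam) (b : ℝ)
    {ζ : ℂ} (hζ : ‖ζ‖ = 1) {r : ℝ} (hr : r ∈ Ioo (0 : ℝ) (1 / 2))
    {a b' : ℂ}
    (ha : Tendsto (fun t ↦ WholePlaneLoewner.BackwardFlow.invMap lam b (cpt ζ r t)⁻¹)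
      (𝓝[>] (-arccos (r / 2))) (𝓝 a))
    (hb : Tendsto (fun t ↦ WholePlaneLoewner.BackwardFlow.invMap lam b (cpt ζ r t)⁻¹)
      (𝓝[<] (arccos (r / 2))) (𝓝 b'))
    {σ : Set ℂ} (hσc : IsPreconnected σ) (hσK : IsCompact σ) (hσG : σ ⊆ C.hull b)
    (haσ : a ∈ σ) (hbσ : b' ∈ σ) {R : ℝ}
    (hRc : ∀ t ∈ Ioo (-arccos (r / 2)) (arccos (r / 2)),
      dist (WholePlaneLoewner.BackwardFlow.invMap lam b (cpt ζ r t)⁻¹) a ≤ R)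
    (hRσ : σ ⊆ closedBall a R)
    (hfar : R < dist (WholePlaneLoewner.BackwardFlow.invMap lam b (-(ζ / 2))⁻¹) a) :
    (fun w : ℂ ↦ WholePlaneLoewner.BackwardFlow.invMap lam b w⁻¹) '' ((ball (0 : ℂ) 1 \ {0}) ∩ ball ζ r) ⊆
      closedBall a R := by
  set Φ : ℂ → ℂ := fun w ↦ WholePlaneLoewner.BackwardFlow.invMap lam b w⁻¹ with hΦ
  set Ψ : ℂ → ℂ := fun z ↦ (C.map b z)⁻¹ with hΨ
  set S₀ : Set ℂ := ball (0 : ℂ) 1 \ {0} with hS₀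
  set G : Set ℂ := (C.hull b)ᶜ with hG
  have hGo : IsOpen G := (C.isCompact_hull b).isClosed.isOpen_compl
  have hΦG : ∀ {w}, w ∈ S₀ → Φ w ∈ G := fun hw ↦
    C.invMap_inv_notMem_hull hlam hw.2 (mem_ball_zero_iff.1 hw.1)
  have hΨΦ : ∀ {w}, w ∈ S₀ → Ψ (Φ w) = w := fun hw ↦
    C.invCoord_invMap_inv hlam hw.2 (mem_ball_zero_iff.1 hw.1)
  have hΦΨ : ∀ {z}, z ∈ G → Φ (Ψ z) = z := fun hz ↦ C.invMap_inv_invCoord hlam hz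
  have hΨS : ∀ {z}, z ∈ G → Ψ z ∈ S₀ := fun hz ↦ C.invCoord_mem hz
  set α := arccos (r / 2) with hα
  have hαpos : 0 < α := arccos_pos.2 (by linarith [hr.2])
  have hαpi : α ≤ π := arccos_le_pi _
  have hR0 : 0 ≤ R := dist_nonneg.trans (hRσ hbσ)
  have hmem : ∀ t ∈ Ioo (-α) α, cpt ζ r t ∈ S₀ := fun t ht ↦
    inter_ball_subset_punctured hζ (cpt_mem_inter hζ hr ht)
  set c : ℝ → ℂ := fun t ↦ Φ (cpt ζ r t) with hc
  set Cc : Set ℂ := c '' Ioo (-α) α with hCdef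
  have hCD : Cc ⊆ G := by
    rintro _ ⟨t, ht, rfl⟩
    exact hΦG (hmem t ht)
  have hCR : Cc ⊆ closedBall a R := by
    rintro _ ⟨t, ht, rfl⟩
    exact mem_closedBall.2 (hRc t ht)
  -- the closed crosscut as a continuous image of `[-α, α]`
  have hΦc : ContinuousOn Φ S₀ := continuousOn_invMap_inv hlam
  have hcc : ContinuousOn c (Ioo (-α) α) := hΦc.comp (continuous_cpt ζ r).continuousOn hmem
  have hlt : -α < α := by linarith
  set cbar : ℝ → ℂ := extendFrom (Ioo (-α) α) c with hcbar
  have hcbar_c : ContinuousOn cbar (Icc (-α) α) := continuousOn_Icc_extendFrom_Ioo hcc ha hb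
  have hcbar_a : cbar (-α) = a := eq_lim_at_left_extendFrom_Ioo hlt ha
  have hcbar_b : cbar α = b' := eq_lim_at_right_extendFrom_Ioo hlt hb
  have hcbar_eq : ∀ t ∈ Ioo (-α) α, cbar t = c t := fun t ht ↦ extendFrom_extends hcc t ht
  set Cbar : Set ℂ := cbar '' Icc (-α) α with hCbar
  have hCbarK : IsCompact Cbar := (isCompact_Icc).image_of_continuousOn hcbar_c
  have hCbar_sub : Cbar ⊆ Cc ∪ {a, b'} := by
    rintro _ ⟨t, ht, rfl⟩
    rcases eq_or_lt_of_le ht.1 with h1 | h1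
    · exact Or.inr (Or.inl (by rw [← h1, hcbar_a]))
    rcases eq_or_lt_of_le ht.2 with h2 | h2
    · exact Or.inr (Or.inr (by rw [h2, hcbar_b]; exact mem_singleton b'))
    · exact Or.inl ⟨t, ⟨h1, h2⟩, (hcbar_eq t ⟨h1, h2⟩).symm⟩
  have hC_sub : Cc ⊆ Cbar := by
    rintro _ ⟨t, ht, rfl⟩
    exact ⟨t, Ioo_subset_Icc_self ht, hcbar_eq t ht⟩
  -- Janiszewski's two compact sets: `A = C̄ ∪ σ` and `B = K_b`
  set A : Set ℂ := Cbar ∪ σ with hA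
  have hAK : IsCompact A := hCbarK.union hσK
  have hAR : A ⊆ closedBall a R := by
    refine union_subset (hCbar_sub.trans (union_subset hCR ?_)) hRσ
    rintro x (rfl | rfl)
    · exact mem_closedBall_self hR0
    · exact hRσ hbσ
  have hBK : IsCompact (C.hull b) := C.isCompact_hull b
  have hAB : A ∩ C.hull b = σ := by
    refine Subset.antisymm ?_ fun x hx ↦ ⟨Or.inr hx, hσG hx⟩
    rintro x ⟨hxA, hxB⟩
    rcases hxA with hxC | hxσ
    · rcases hCbar_sub hxC with hxC' | (rfl | rfl)
      · exact absurd hxB (hCD hxC')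
      · exact haσ
      · exact hbσ
    · exact hxσ
  -- suppose some `Φ z` of the near side is far from `a`
  rintro w ⟨z, ⟨hz, hzr⟩, rfl⟩
  by_contra hwR
  rw [mem_closedBall, not_le] at hwR
  set q : ℂ := -(ζ / 2) with hq
  have hqS : q ∈ S₀ := by
    refine ⟨mem_ball_zero_iff.2 ?_, fun h0 ↦ ?_⟩
    · rw [hq, norm_neg, norm_div, hζ]; norm_num
    · rw [mem_singleton_iff, hq, neg_eq_zero, div_eq_zero_iff] at h0
      rcases h0 with h0 | h0
      · rw [h0, norm_zero] at hζ; exact zero_ne_one hζ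
      · norm_num at h0
  have hqG : Φ q ∈ G := hΦG hqS
  have hwD : Φ z ∈ G := hΦG hz
  have hGc : IsPreconnected G := (C.isConnected_compl_hull b).isPreconnected
  -- neither `A` nor `K_b` separates `Φ q` from `Φ z`
  have hSA : ∃ S ⊆ Aᶜ, IsPreconnected S ∧ Φ q ∈ S ∧ Φ z ∈ S :=
    ⟨{x | R < dist x a}, fun x hx hxA ↦ (not_le.2 hx) (mem_closedBall.1 (hAR hxA)),
      isPreconnected_setOf_lt_dist a hR0, hfar, hwR⟩
  have hSB : ∃ S ⊆ (C.hull b)ᶜ, IsPreconnected S ∧ Φ q ∈ S ∧ Φ z ∈ S :=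
    ⟨G, Subset.rfl, hGc, hqG, hwD⟩
  obtain ⟨V, hV, hVc, hqV, hwV⟩ :=
    Literature.Topology.PlaneTopology.janiszewski' hAK hBK (hAB ▸ hσc) hSA hSB
  have hVD : V ⊆ G := fun x hx hxK ↦ hV hx (Or.inr hxK)
  have hVC : ∀ x ∈ V, x ∉ Cc := fun x hx hxC ↦ hV hx (Or.inl (Or.inl (hC_sub hxC)))
  -- pull back to the punctured disc and apply the intermediate value theorem to `|· - ζ|`
  set V' : Set ℂ := Ψ '' V with hV'
  have hV'c : IsPreconnected V' := hVc.image _ ((C.continuousOn_invCoord b).mono hVD)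
  have hV'S : V' ⊆ S₀ := by
    rintro _ ⟨x, hx, rfl⟩
    exact hΨS (hVD hx)
  have hqV' : q ∈ V' := ⟨Φ q, hqV, hΨΦ hqS⟩
  have hzV' : z ∈ V' := ⟨Φ z, hwV, hΨΦ hz⟩
  have hfc : ContinuousOn (fun x : ℂ ↦ ‖x - ζ‖) V' := by fun_prop
  have hfz : ‖z - ζ‖ < r := by rwa [mem_ball, dist_eq_norm] at hzr
  have hfq : ‖q - ζ‖ = 3 / 2 := by
    rw [hq, show -(ζ / 2) - ζ = (-(3 / 2 : ℝ) : ℂ) * ζ by push_cast; ring, norm_mul, norm_neg,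
      Complex.norm_real, hζ]
    norm_num
  obtain ⟨u, huV', hur⟩ : ∃ u ∈ V', ‖u - ζ‖ = r := by
    have := hV'c.intermediate_value hzV' hqV' hfc ⟨hfz.le, by rw [hfq]; linarith [hr.2]⟩
    obtain ⟨u, hu, hur⟩ := this
    exact ⟨u, hu, hur⟩
  obtain ⟨x, hxV, rfl⟩ := huV'
  have hxD : x ∈ G := hVD hxV
  have hΦu : Φ (Ψ x) = x := hΦΨ hxD
  -- `Ψ x` is a point of the crosscut arc
  obtain ⟨t, ht, hteq⟩ := exists_eq_cpt hζ hr.1 hur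
  have htabs : |t| ≤ π := abs_le.2 ⟨ht.1.le, ht.2⟩
  have hball : cpt ζ r t ∈ ball (0 : ℂ) 1 := hteq ▸ (hV'S ⟨x, hxV, rfl⟩).1
  have htα : |t| < α := (mem_ball_cpt_iff_abs_lt hζ hr.1 (by linarith [hr.2]) htabs).1 hball
  have hmemC : Φ (Ψ x) ∈ Cc := ⟨t, abs_lt.1 htα, by rw [hteq]⟩
  rw [hΦu] at hmemC
  exact hVC x hxV hmemC

/-- **Equicontinuity of `Φ_b` at boundary points when `K_b` is uniformly locally connected**: for
every `ε₀ > 0` and `ζ ∈ ∂𝔻` there is `ρ > 0` such that `Φ_b` oscillates by less than `ε₀` on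
`(𝔻 ∖ {0}) ∩ {|w - ζ| < ρ}`. Pommerenke (1992), proof of Thm. 2.1, (iv) ⇒ (i).
[cite: PommerenkeBBCM1992, Thm. 2.1] -/
theorem exists_forall_dist_lt_of_ulc (C : WholePlaneLoewnerChain lam) (hlam : Continuous lam) {b : ℝ}
    (hlc : IsUniformlyLocallyConnected (C.hull b)) {ζ : ℂ}
    (hζ : ‖ζ‖ = 1) {ε₀ : ℝ} (hε₀ : 0 < ε₀) :
    ∃ ρ > 0, ∀ z ∈ ball (0 : ℂ) 1 \ {0}, dist z ζ < ρ → ∀ z' ∈ ball (0 : ℂ) 1 \ {0}, dist z' ζ < ρ →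
      dist (WholePlaneLoewner.BackwardFlow.invMap lam b z⁻¹)
        (WholePlaneLoewner.BackwardFlow.invMap lam b z'⁻¹) < ε₀ := by
  set Φ : ℂ → ℂ := fun w ↦ WholePlaneLoewner.BackwardFlow.invMap lam b w⁻¹ with hΦ
  set S₀ : Set ℂ := ball (0 : ℂ) 1 \ {0} with hS₀
  set q : ℂ := -(ζ / 2) with hq
  have hqS : q ∈ S₀ := by
    refine ⟨mem_ball_zero_iff.2 ?_, fun h0 ↦ ?_⟩
    · rw [hq, norm_neg, norm_div, hζ]; norm_num
    · rw [mem_singleton_iff, hq, neg_eq_zero, div_eq_zero_iff] at h0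
      rcases h0 with h0 | h0
      · rw [h0, norm_zero] at hζ; exact zero_ne_one hζ
      · norm_num at h0
  -- `Φ q` is at positive distance `d₀` from `K_b`
  have hGo : IsOpen (C.hull b)ᶜ := (C.isCompact_hull b).isClosed.isOpen_compl
  obtain ⟨d₀, hd₀, hballΩ⟩ := Metric.isOpen_iff.1 hGo (Φ q)
    (C.invMap_inv_notMem_hull hlam hqS.2 (mem_ball_zero_iff.1 hqS.1))
  have hfarK : ∀ a ∈ C.hull b, d₀ ≤ dist (Φ q) a := fun a ha ↦ by
    by_contra h
    exact hballΩ (by rw [mem_ball']; exact not_le.1 h) ha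
  set η := min (ε₀ / 4) (d₀ / 2) with hη
  have hηpos : 0 < η := lt_min (by linarith) (by linarith)
  obtain ⟨ε₁, hε₁, harc⟩ := hlc η hηpos
  set ε := min (ε₁ / 2) η with hε
  have hεpos : 0 < ε := lt_min (by linarith) hηpos
  -- a short crosscut at `ζ`
  have hbdd : Bornology.IsBounded (Φ '' (ball (0 : ℂ) 1 ∩ ball ζ (1 / 2))) := by
    refine (isBounded_iff_forall_norm_le).2 ⟨4 * 2 * Real.exp b, ?_⟩
    rintro _ ⟨w, ⟨hw, hwζ⟩, rfl⟩
    refine norm_invMap_inv_le hlam b (mem_ball_zero_iff.1 hw) ?_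
    have h1 : dist w ζ < 1 / 2 := mem_ball.1 hwζ
    have h2 : (1 : ℝ) ≤ ‖w‖ + dist w ζ := by
      calc (1 : ℝ) = ‖ζ‖ := hζ.symm
        _ = ‖w + (ζ - w)‖ := by rw [add_sub_cancel]
        _ ≤ ‖w‖ + ‖ζ - w‖ := norm_add_le _ _
        _ = ‖w‖ + dist w ζ := by rw [dist_comm, dist_eq_norm]
    linarith
  obtain ⟨r, hr, -, a, b', ha, hb, hRc, hRb⟩ :=
    exists_short_crosscut_punctured (differentiableOn_invMap_inv hlam b) (C.injOn_invMap_inv hlam b)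
      hbdd hζ hεpos
  -- its endpoints are in `K_b`
  set α := arccos (r / 2) with hα
  have hαpos : 0 < α := arccos_pos.2 (by linarith [hr.2])
  have hαpi : α ≤ π := arccos_le_pi _
  have hmem : ∀ t ∈ Ioo (-α) α, cpt ζ r t ∈ S₀ := fun t ht ↦
    inter_ball_subset_punctured hζ (cpt_mem_inter hζ hr ht)
  have haK : a ∈ C.hull b := by
    refine C.mem_hull_of_tendsto hlam b (l := 𝓝[>] (-α)) ?_ (JordanDomain.norm_cpt_arccos hζ
      ⟨hr.1, by linarith [hr.2]⟩ (-α) (by rw [abs_neg, abs_of_pos hαpos])) ?_ ha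
    · filter_upwards [Ioo_mem_nhdsGT (by linarith : -α < α)] with t ht using hmem t ht
    · exact ((continuous_cpt ζ r).tendsto (-α)).mono_left nhdsWithin_le_nhds
  have hbK : b' ∈ C.hull b := by
    refine C.mem_hull_of_tendsto hlam b (l := 𝓝[<] α) ?_ (JordanDomain.norm_cpt_arccos hζ
      ⟨hr.1, by linarith [hr.2]⟩ α (abs_of_pos hαpos)) ?_ hb
    · filter_upwards [Ioo_mem_nhdsLT (by linarith : -α < α)] with t ht using hmem t ht
    · exact ((continuous_cpt ζ r).tendsto α).mono_left nhdsWithin_le_nhds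
  obtain ⟨σ, hσG, hσK, hσc, haσ, hbσ, hRσ⟩ := harc a haK b' hbK (hRb.trans_lt (by
    calc ε ≤ ε₁ / 2 := min_le_left _ _
      _ < ε₁ := by linarith))
  have hεη : ε ≤ η := min_le_right _ _
  have hW := C.image_inter_ball_subset_of_hull hlam b hζ hr ha hb hσc hσK hσG haσ hbσ
    (R := η) (fun t ht ↦ (hRc t ht).trans hεη) hRσ (by
      calc η ≤ d₀ / 2 := min_le_right _ _
        _ < d₀ := by linarith
        _ ≤ dist (Φ q) a := hfarK a haK)
  refine ⟨r, hr.1, fun z hz hzr z' hz' hz'r ↦ ?_⟩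
  have h1 : Φ z ∈ closedBall a η := hW ⟨z, ⟨hz, hzr⟩, rfl⟩
  have h2 : Φ z' ∈ closedBall a η := hW ⟨z', ⟨hz', hz'r⟩, rfl⟩
  rw [mem_closedBall] at h1 h2
  calc dist (Φ z) (Φ z') ≤ dist (Φ z) a + dist (Φ z') a := dist_triangle_right _ _ _
    _ ≤ η + η := add_le_add h1 h2
    _ ≤ ε₀ / 4 + ε₀ / 4 := add_le_add (min_le_left _ _) (min_le_left _ _)
    _ < ε₀ := by linarith

/-- Points of the closed punctured disc are limits of points of the open punctured disc. [folklore] -/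
theorem _root_.Literature.Probability.RandomPlanarGeometry.closedBall_diff_zero_subset_closure :
    closedBall (0 : ℂ) 1 \ {0} ⊆ closure (ball (0 : ℂ) 1 \ {0}) := by
  rintro x ⟨hx, hx0⟩
  rw [mem_singleton_iff] at hx0
  rw [Metric.mem_closure_iff]
  intro ε hε
  have hxn : 0 < ‖x‖ := norm_pos_iff.2 hx0
  have hx1 : ‖x‖ ≤ 1 := mem_closedBall_zero_iff.1 hx
  set δ : ℝ := min (ε / 2) (1 / 2) with hδ
  have hδpos : 0 < δ := lt_min (by linarith) (by norm_num)
  have hδ1 : δ < 1 := (min_le_right _ _).trans_lt (by norm_num)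
  refine ⟨((1 - δ : ℝ) : ℂ) * x, ⟨mem_ball_zero_iff.2 ?_, ?_⟩, ?_⟩
  · rw [norm_mul, Complex.norm_real, Real.norm_eq_abs, abs_of_pos (by linarith)]
    calc (1 - δ) * ‖x‖ ≤ (1 - δ) * 1 := by gcongr
      _ < 1 := by linarith
  · rw [mem_singleton_iff, mul_eq_zero, not_or]
    exact ⟨by exact_mod_cast (by linarith : (1 - δ : ℝ) ≠ 0), hx0⟩
  · rw [dist_eq_norm, show x - ((1 - δ : ℝ) : ℂ) * x = ((δ : ℝ) : ℂ) * x by push_cast; ring,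
      norm_mul, Complex.norm_real, Real.norm_eq_abs, abs_of_pos hδpos]
    calc δ * ‖x‖ ≤ ε / 2 * 1 := by gcongr; exact min_le_left _ _
      _ < ε := by linarith

/-- Under uniform local connectedness of `K_b`, `Φ_b` has a limit within the punctured disc at
every point of the closed punctured disc. [cite: PommerenkeBBCM1992, Thm. 2.1] -/
theorem exists_tendsto_of_ulc (C : WholePlaneLoewnerChain lam) (hlam : Continuous lam) {b : ℝ}
    (hlc : IsUniformlyLocallyConnected (C.hull b)) {x : ℂ}
    (hx : x ∈ closedBall (0 : ℂ) 1 \ {0}) :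
    ∃ y, Tendsto (fun w : ℂ ↦ WholePlaneLoewner.BackwardFlow.invMap lam b w⁻¹)
      (𝓝[ball (0 : ℂ) 1 \ {0}] x) (𝓝 y) := by
  set Φ : ℂ → ℂ := fun w ↦ WholePlaneLoewner.BackwardFlow.invMap lam b w⁻¹ with hΦ
  rcases eq_or_lt_of_le (mem_closedBall_zero_iff.1 hx.1) with h | h
  · haveI : NeBot (𝓝[ball (0 : ℂ) 1 \ {0}] x) :=
      mem_closure_iff_nhdsWithin_neBot.1 (closedBall_diff_zero_subset_closure hx)
    have hC : Cauchy (Filter.map Φ (𝓝[ball (0 : ℂ) 1 \ {0}] x)) := by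
      rw [Metric.cauchy_iff]
      refine ⟨inferInstance, fun ε hε ↦ ?_⟩
      obtain ⟨ρ, hρ, hρ'⟩ := C.exists_forall_dist_lt_of_ulc hlam hlc h hε
      refine ⟨Φ '' ((ball 0 1 \ {0}) ∩ ball x ρ),
        image_mem_map (inter_mem_nhdsWithin _ (ball_mem_nhds x hρ)), ?_⟩
      rintro _ ⟨z, ⟨hz, hzρ⟩, rfl⟩ _ ⟨z', ⟨hz', hz'ρ⟩, rfl⟩
      exact hρ' z hz hzρ z' hz' hz'ρ
    obtain ⟨y, hy⟩ := CompleteSpace.complete hC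
    exact ⟨y, hy⟩
  · have hxS : x ∈ ball (0 : ℂ) 1 \ {0} := ⟨mem_ball_zero_iff.2 h, hx.2⟩
    exact ⟨Φ x, (continuousOn_invMap_inv hlam).continuousWithinAt hxS⟩

/-- **Carathéodory's continuity theorem for the whole-plane map.** If `K_b` is uniformly locally
connected then `Φ_b(w) = F_b(1/w)` extends continuously from the punctured disc to the closed
punctured disc: `extendFrom (𝔻 ∖ {0}) Φ_b` is continuous on `𝔻̄ ∖ {0}`, agrees with `Φ_b` on
`𝔻 ∖ {0}`, and is the limit of `Φ_b` at every point of `𝔻̄ ∖ {0}`. Pommerenke (1992), Thm. 2.1,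
(iv) ⇒ (i). [cite: PommerenkeBBCM1992, Thm. 2.1] -/
theorem continuousOn_extendFrom_invMap_inv (C : WholePlaneLoewnerChain lam) (hlam : Continuous lam) {b : ℝ}
    (hlc : IsUniformlyLocallyConnected (C.hull b)) :
    ContinuousOn (extendFrom (ball (0 : ℂ) 1 \ {0})
        (fun w : ℂ ↦ WholePlaneLoewner.BackwardFlow.invMap lam b w⁻¹)) (closedBall (0 : ℂ) 1 \ {0}) ∧
      (∀ x ∈ ball (0 : ℂ) 1 \ {0}, extendFrom (ball (0 : ℂ) 1 \ {0})
        (fun w : ℂ ↦ WholePlaneLoewner.BackwardFlow.invMap lam b w⁻¹) x =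
          WholePlaneLoewner.BackwardFlow.invMap lam b x⁻¹) ∧
      ∀ x ∈ closedBall (0 : ℂ) 1 \ {0}, Tendsto (fun w : ℂ ↦ WholePlaneLoewner.BackwardFlow.invMap lam b w⁻¹)
        (𝓝[ball (0 : ℂ) 1 \ {0}] x)
        (𝓝 (extendFrom (ball (0 : ℂ) 1 \ {0})
          (fun w : ℂ ↦ WholePlaneLoewner.BackwardFlow.invMap lam b w⁻¹) x)) :=
  ⟨continuousOn_extendFrom (closedBall_diff_zero_subset_closure)
      fun _ hx ↦ C.exists_tendsto_of_ulc hlam hlc hx,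
    fun x hx ↦ extendFrom_extends (continuousOn_invMap_inv hlam) x hx,
    fun _ hx ↦ tendsto_extendFrom (C.exists_tendsto_of_ulc hlam hlc hx)⟩

/-- **Boundary values of the extension lie in `K_b`.** [folklore] -/
theorem extendFrom_invMap_inv_mem_hull (C : WholePlaneLoewnerChain lam) (hlam : Continuous lam) {b : ℝ}
    (hlc : IsUniformlyLocallyConnected (C.hull b)) {x : ℂ}
    (hx : ‖x‖ = 1) :
    extendFrom (ball (0 : ℂ) 1 \ {0}) (fun w : ℂ ↦ WholePlaneLoewner.BackwardFlow.invMap lam b w⁻¹) x ∈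
      C.hull b := by
  have hxmem : x ∈ closedBall (0 : ℂ) 1 \ {0} := by
    refine ⟨mem_closedBall_zero_iff.2 hx.le, fun h0 ↦ ?_⟩
    rw [mem_singleton_iff] at h0
    rw [h0, norm_zero] at hx
    exact zero_ne_one hx
  haveI : NeBot (𝓝[ball (0 : ℂ) 1 \ {0}] x) :=
    mem_closure_iff_nhdsWithin_neBot.1 (closedBall_diff_zero_subset_closure hxmem)
  have hlim := (C.continuousOn_extendFrom_invMap_inv hlam hlc).2.2 x hxmem
  exact C.mem_hull_of_tendsto hlam b (l := 𝓝[ball (0 : ℂ) 1 \ {0}] x) (g := id)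
    self_mem_nhdsWithin hx (tendsto_nhdsWithin_of_tendsto_nhds tendsto_id)
    hlim

end WholePlaneLoewnerChain

end Literature.Probability.RandomPlanarGeometry
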